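import Mathlib.Data.List.GetD
import Literature.MathematicalPhysics.QuantumLattice.ProductOperators
import HarnessLib

/-!
# Algebraic Bethe ansatz for the inhomogeneous spin-½ XXX chain

Trunk T-QLATTICE, topic `MathematicalPhysics/QuantumLattice`. This file formalises, with complete
proofs, the algebraic Bethe ansatz for the inhomogeneous XXX (Yang `R`-matrix) spin chain as it is
used in the nested Bethe ansatz of the one-dimensional Hubbard model: F. H. L. Essler, H. Frahm,
F. Göhmann, A. Klümper, V. E. Korepin, *The One-Dimensional Hubbard Model* (CUP 2005), Appendix
3.B.5 "Algebraic solution of the spin problem", eqs. (3.B.50)–(3.B.85), together with the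
exchange relation (3.B.31) of adjacent inhomogeneities (held: `book:essler2005-one-dimensional-
hubbard-model`, PDF pp. 113–123). It is the "spin part" of the Bethe-ansatz eigenvector theorem for
the Hubbard chain (Lieb–Wu 1968, eqs. (3)–(11); Essler et al. §3.2–3.3 and App. 3.B), census item
(1) in the module docstring of `LiebWuBetheAnsatz.lean` (node F2c of `lieb_wu`); the charge part
(coordinate wave function (3.B.90), periodicity (3.B.37)–(3.B.47)) is not in this file.

## Contents (all statements proved; no named facts)

Operators live in the tree's spin-system algebra `Op Λ 2 = Matrix (Λ → Fin 2) (Λ → Fin 2) ℂ`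
(`SpinSystem.lean`, decision Q-D1), the auxiliary space is an explicit `Fin 2` matrix index.
* `InhomXXX.sUnit x a b = |a⟩⟨b|_x` (an `onSite` matrix unit) and its algebra.
* `InhomXXX.lax η x c : Matrix (Fin 2) (Fin 2) (Op Λ 2)`, the (unnormalised, polynomial) Lax
  operator `L_x(c) = c·1 + η·P_{aux,x}`, entries `L_x(c)_{ab} = c δ_{ab} + η |b⟩⟨a|_x` ((3.B.60) up
  to the scalar `1/(λ + iu)`, see "Conventions").
* `InhomXXX.akron X Y = X ⊠ Y`, `InhomXXX.rCheck Λ η d = Ř(d) = η + d·P` on two auxiliary spaces,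
  the local RTT relation `lax_rtt'` (3.B.61) and, by induction over the chain, the **RTT relation**
  `monodromy_rtt` (3.B.63) for the monodromy matrix `InhomXXX.monodromy η λ l` of a chain given as
  a list `l = [(x₁,s₁), …, (xₙ,sₙ)]` of distinct sites with inhomogeneities,
  `T(λ) = L_{x₁}(λ - s₁) ⋯ L_{xₙ}(λ - sₙ)` (3.B.62).
* `opA, opB, opC, opD, transfer` (3.B.69), (3.B.55); the exchange relations `opB_comm` (3.B.70),
  `opA_opB` (3.B.71), `opD_opB` (3.B.72) in polynomial form
  `(λ-μ) A(λ)B(μ) = (λ-μ-η) B(μ)A(λ) + η B(λ)A(μ)`, `(λ-μ) D(λ)B(μ) = (λ-μ+η) B(μ)D(λ) - η B(λ)D(μ)`.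
* The reference state `vac = |↑⋯↑⟩` with `A|0⟩ = a(λ)|0⟩`, `D|0⟩ = d(λ)|0⟩`, `C|0⟩ = 0`,
  `a(λ) = ∏ (λ - s_x + η)`, `d(λ) = ∏ (λ - s_x)` (`aEig`, `dEig`; (3.B.73)–(3.B.74)).
* **Off-shell theorem** `opA_bString_vac`, `opD_bString_vac` ((3.B.76)–(3.B.80)): the action of
  `A(λ)`, `D(λ)` on `𝔅(λ⃗)|0⟩ = B(λ₁)⋯B(λ_M)|0⟩` with the explicit "unwanted" coefficients, proved by
  induction on `M` (the printed argument "by symmetry in the `λ_j`" is replaced by the recursion for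
  the coefficients, `coefA_recursion_identity`, `coefD_recursion_identity`).
* **On-shell theorem** `transfer_bString_vac` ((3.B.81)–(3.B.85)): under the Bethe equations
  (divided form `coefA = coefD`; from the polynomial form (3.B.82)–(3.B.83) by
  `coefA_eq_coefD_of_bethe`), `𝔅(λ⃗)|0⟩` is an eigenvector of `t(λ) = A(λ) + D(λ)` for every
  `λ ∉ {λ_j}` with eigenvalue `a(λ)∏(λ-λ_j-η)/(λ-λ_j) + d(λ)∏(λ-λ_j+η)/(λ-λ_j)` (3.B.84).
* **Exchange of adjacent inhomogeneities** `monodromy_swap`, `bString_swap`,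
  `swapR_mulVec_bString_vac`: with `R = (s - s') + η P_{xy}` (the quantum-space Yang–Baxter
  equation `lax_lax_swap`, (3.B.49)), `T_{…(x,s),(y,s')…} R = R T_{…(y,s'),(x,s)…}` entrywise, hence
  `R 𝔅'(λ⃗)|0⟩ = (s - s' + η) 𝔅(λ⃗)|0⟩`: the Bethe vectors for interchanged inhomogeneities differ by
  Yang's operator `Y_{xy}(s - s') = ((s - s') + η P_{xy})/((s - s') + η)` — Essler et al. (3.B.31)–
  (3.B.32), here a CONSEQUENCE of the algebraic definition (3.B.75) of the amplitudes rather than a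
  recursion requiring the consistency argument of App. 3.C.2.

## Conventions

`η ∈ ℂ` is the crossing parameter; for the Hubbard chain with `u = U/(4t)`: `η = 2iu`. Essler et
al.'s normalised Lax operator (3.B.60) is `L_n(λ) = (λ + iu σ^α σ^α_n)/(λ + iu)
= ((λ - iu) + 2iu P_{a n})/(λ + iu)`, i.e. `lax (2iu) n (λ - iu) = (λ + iu) • L_n(λ)`; their monodromy
matrix (3.B.62) `L_N(λ - s_{P(N)}) ⋯ L_1(λ - s_{P(1)})` is, up to the scalar
`∏_j (λ - s_{P(j)} + iu)⁻¹`, `monodromy (2iu) λ [(N, s_{P(N)} + iu), …, (1, s_{P(1)} + iu)]` (first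
list entry = leftmost factor). With these substitutions `dEig/aEig = ∏ (λ - s_j - iu)/(λ - s_j + iu)`
is (3.B.74) and the polynomial Bethe equations of `coefA_eq_coefD_of_bethe` are exactly the spin
part (3.96) = (3.B.83) of the Lieb–Wu equations. Spin `↑ = (0 : Fin 2)`, `↓ = 1`; `B = T₀₁` creates a
down spin. All `R`-matrices are unnormalised (polynomial in the spectral parameters), so no
genericity hypotheses are needed except pairwise distinctness of `λ, λ₁, …, λ_M` where rational
coefficients are printed, and `η ≠ 0` for `[B(λ), B(μ)] = 0`.

## Not in this file

The trace identities at `λ = s_x` (regularity, shift operator; Essler (3.B.53)–(3.B.54), (3.B.66)–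
(3.B.68)), the coordinate Bethe wave function of the Hubbard chain and its Schrödinger equation
(App. 3.B.1–3.B.4), explicit amplitudes (App. 3.E), `SU(2)` highest-weight properties (App. 3.D),
norms and completeness (§3.5, Ch. 4), and the homogeneous XXX Hamiltonian as a logarithmic
derivative of `t(λ)` (Ch. 12).

## References

* F. H. L. Essler, H. Frahm, F. Göhmann, A. Klümper, V. E. Korepin, *The One-Dimensional Hubbard
  Model*, Cambridge University Press 2005, App. 3.B.5, eqs. (3.B.49)–(3.B.85), and (3.B.31)–(3.B.32)
  (key `EsslerEtAl2005`; held, PDF pp. 113–123).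
* E. H. Lieb, F. Y. Wu, PRL 20 (1968) 1445, eqs. (9)–(11) (the Lieb–Wu equations whose spin part is
  (3.B.83)). [LiebWuPRL1968]
-/

noncomputable section

open Matrix Complex Finset

namespace Literature.MathematicalPhysics.QuantumLattice

namespace InhomXXX

variable {Λ : Type*} [Fintype Λ] [DecidableEq Λ]

/-- The matrix unit `|a⟩⟨b|` at site `x`. [folklore] -/
def sUnit (x : Λ) (a b : Fin 2) : Op Λ 2 := onSite x (Matrix.single a b 1)

/-- `onSite x 0 = 0`. [folklore] -/
theorem onSite_zero' (x : Λ) : (onSite x (0 : Matrix (Fin 2) (Fin 2) ℂ) : Op Λ 2) = 0 := by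
  simpa using onSite_smul' (q := 2) x (0 : ℂ) (1 : Matrix (Fin 2) (Fin 2) ℂ)

/-- Matrix-unit algebra at one site: `|a⟩⟨b| · |c⟩⟨d| = δ_{bc} |a⟩⟨d|`. [folklore] -/
theorem sUnit_mul_sUnit (x : Λ) (a b c d : Fin 2) :
    sUnit x a b * sUnit x c d = if b = c then sUnit x a d else 0 := by
  unfold sUnit
  rw [onSite_mul]
  split_ifs with h
  · subst h
    rw [single_mul_single_same, mul_one]
  · rw [single_mul_single_of_ne (h := h), onSite_zero']

/-- Matrix units at distinct sites commute. [folklore] -/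
theorem sUnit_comm {x y : Λ} (hxy : x ≠ y) (a b c d : Fin 2) :
    sUnit x a b * sUnit y c d = sUnit y c d * sUnit x a b :=
  onSite_mul_onSite_comm hxy _ _

/-- Completeness at one site: `Σ_a |a⟩⟨a|_x = 1`. [folklore] -/
theorem sum_sUnit_diag (x : Λ) : ∑ a, sUnit x a a = (1 : Op Λ 2) := by
  unfold sUnit
  rw [Fin.sum_univ_two, ← onSite_add', ← onSite_one' x]
  congr 1
  ext i j
  fin_cases i <;> fin_cases j <;> simp

/-- Lax operator `L_x(c) = c·1 + η·P_{aux,x}`: entry `(a,b)` is `c δ_{ab} + η |b⟩⟨a|_x`.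
[cite: EsslerEtAl2005, eq. (3.B.60)] -/
def lax (η : ℂ) (x : Λ) (c : ℂ) : Matrix (Fin 2) (Fin 2) (Op Λ 2) :=
  of fun a b => (if a = b then c • (1 : Op Λ 2) else 0) + η • sUnit x b a

/-- Entries of the Lax operator (definitional unfolding).
[cite: EsslerEtAl2005, eq. (3.B.60)] -/
theorem lax_apply (η : ℂ) (x : Λ) (c : ℂ) (a b : Fin 2) :
    lax η x c a b = (if a = b then c • (1 : Op Λ 2) else 0) + η • sUnit x b a := rfl

/-- The fundamental (local) RTT relation for one Lax operator. [cite: EsslerEtAl2005, eq. (3.B.61)] -/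
theorem lax_rtt (η : ℂ) (x : Λ) (c c' : ℂ) (a b e f : Fin 2) :
    η • (lax η x c a e * lax η x c' b f) + (c - c') • (lax η x c b e * lax η x c' a f) =
      η • (lax η x c' a e * lax η x c b f) + (c - c') • (lax η x c' a f * lax η x c b e) := by
  simp only [lax_apply, add_mul, mul_add, smul_mul_assoc, mul_smul_comm, one_mul, mul_one,
    sUnit_mul_sUnit, ite_mul, mul_ite, zero_mul, mul_zero, smul_add, smul_zero, smul_ite,
    smul_smul]
  rcases Fin.exists_fin_two.mp ⟨a, rfl⟩ with rfl | rfl <;>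
  rcases Fin.exists_fin_two.mp ⟨b, rfl⟩ with rfl | rfl <;>
  rcases Fin.exists_fin_two.mp ⟨e, rfl⟩ with rfl | rfl <;>
  rcases Fin.exists_fin_two.mp ⟨f, rfl⟩ with rfl | rfl <;>
  · simp <;> module


/-! ### Auxiliary-space tensor formalism and the RTT relation -/

/-- `X ⊠ Y`: the `4 × 4` operator matrix `(X ⊠ Y)_{(a,b),(c,d)} = X_{ac} Y_{bd}` (ordered product of
the operator entries). [cite: EsslerEtAl2005, eq. (3.B.63)] -/
def akron (X Y : Matrix (Fin 2) (Fin 2) (Op Λ 2)) : Matrix (Fin 2 × Fin 2) (Fin 2 × Fin 2) (Op Λ 2) :=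
  of fun p q => X p.1 q.1 * Y p.2 q.2

/-- Entries of `X ⊠ Y` (definitional unfolding). [folklore] -/
theorem akron_apply (X Y : Matrix (Fin 2) (Fin 2) (Op Λ 2)) (p q : Fin 2 × Fin 2) :
    akron X Y p q = X p.1 q.1 * Y p.2 q.2 := rfl

/-- Mixed interchange law `(XX') ⊠ (YY') = (X ⊠ Y)(X' ⊠ Y')` when the entries of `X'` commute with
those of `Y`. [folklore] -/
theorem akron_mul (X X' Y Y' : Matrix (Fin 2) (Fin 2) (Op Λ 2))
    (h : ∀ a b c d, X' a b * Y c d = Y c d * X' a b) :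
    akron (X * X') (Y * Y') = akron X Y * akron X' Y' := by
  refine Matrix.ext fun p q => ?_
  simp only [akron_apply, Matrix.mul_apply, Fintype.sum_prod_type]
  rw [Finset.sum_mul_sum]
  refine Finset.sum_congr rfl fun r _ => Finset.sum_congr rfl fun s _ => ?_
  rw [mul_assoc, mul_assoc, ← mul_assoc (X' r q.1), h, mul_assoc]

/-- `1 ⊠ 1 = 1`. [folklore] -/
@[simp] theorem akron_one : akron (1 : Matrix (Fin 2) (Fin 2) (Op Λ 2)) 1 = 1 := by
  refine Matrix.ext fun p q => ?_
  rcases p with ⟨a, b⟩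
  rcases q with ⟨c, d⟩
  simp only [akron_apply, Matrix.one_apply, Prod.mk.injEq]
  by_cases h : a = c <;> by_cases h' : b = d <;> simp [h, h']

variable (Λ) in
/-- The `R`-matrix `Ř(d) = η·1 + d·P` on the tensor product of two auxiliary spaces (scalar
entries). [cite: EsslerEtAl2005, eq. (3.B.58)] -/
def rCheck (η d : ℂ) : Matrix (Fin 2 × Fin 2) (Fin 2 × Fin 2) (Op Λ 2) :=
  of fun p q => ((if q = p then η else 0) + (if q = (p.2, p.1) then d else 0)) • (1 : Op Λ 2)

omit [DecidableEq Λ] in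
/-- Entries of `Ř(d)` (definitional unfolding). [cite: EsslerEtAl2005, eq. (3.B.58)] -/
theorem rCheck_apply (η d : ℂ) (p q : Fin 2 × Fin 2) :
    rCheck Λ η d p q =
      ((if q = p then η else 0) + (if q = (p.2, p.1) then d else 0)) • (1 : Op Λ 2) := rfl

/-- Left action of `Ř(d) = η + d P`: `(Ř Z)_{(a,b),q} = η Z_{(a,b),q} + d Z_{(b,a),q}`. [folklore] -/
theorem rCheck_mul_apply (η d : ℂ) (Z : Matrix (Fin 2 × Fin 2) (Fin 2 × Fin 2) (Op Λ 2))
    (p q : Fin 2 × Fin 2) : (rCheck Λ η d * Z) p q = η • Z p q + d • Z (p.2, p.1) q := by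
  simp only [Matrix.mul_apply, rCheck_apply, add_smul, ite_smul, zero_smul, add_mul, ite_mul,
    zero_mul, smul_mul_assoc, one_mul, Finset.sum_add_distrib, Finset.sum_ite_eq',
    Finset.mem_univ, if_true]

/-- Right action of `Ř(d) = η + d P`: `(Z Ř)_{p,(c,d)} = η Z_{p,(c,d)} + d Z_{p,(d,c)}`. [folklore] -/
theorem mul_rCheck_apply (η d : ℂ) (Z : Matrix (Fin 2 × Fin 2) (Fin 2 × Fin 2) (Op Λ 2))
    (p q : Fin 2 × Fin 2) : (Z * rCheck Λ η d) p q = η • Z p q + d • Z p (q.2, q.1) := by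
  have h : ∀ x : Fin 2 × Fin 2, (q = (x.2, x.1)) = (x = (q.2, q.1)) := by
    intro x
    rcases x with ⟨x1, x2⟩
    rcases q with ⟨q1, q2⟩
    simp only [Prod.mk.injEq, eq_iff_iff]
    tauto
  simp only [Matrix.mul_apply, rCheck_apply, add_smul, ite_smul, zero_smul, mul_add, mul_ite,
    mul_zero, mul_smul_comm, mul_one, Finset.sum_add_distrib, Finset.sum_ite_eq,
    Finset.mem_univ, if_true, h, Finset.sum_ite_eq']

/-- The RTT relation `Ř(d) (X ⊠ Y) = (Y ⊠ X) Ř(d)` in components.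
[cite: EsslerEtAl2005, eq. (3.B.63)] -/
theorem rtt_iff (η d : ℂ) (X Y : Matrix (Fin 2) (Fin 2) (Op Λ 2)) :
    rCheck Λ η d * akron X Y = akron Y X * rCheck Λ η d ↔
      ∀ a b e f : Fin 2, η • (X a e * Y b f) + d • (X b e * Y a f) =
        η • (Y a e * X b f) + d • (Y a f * X b e) := by
  constructor
  · intro h a b e f
    have := congr_fun (congr_fun h (a, b)) (e, f)
    simpa only [rCheck_mul_apply, mul_rCheck_apply, akron_apply] using this
  · intro h
    refine Matrix.ext fun p q => ?_
    simpa only [rCheck_mul_apply, mul_rCheck_apply, akron_apply] using h p.1 p.2 q.1 q.2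

/-- The local RTT relation in matrix form `Ř(c - c') (L(c) ⊠ L(c')) = (L(c') ⊠ L(c)) Ř(c - c')`.
[cite: EsslerEtAl2005, eq. (3.B.61)] -/
theorem lax_rtt' (η : ℂ) (x : Λ) (c c' : ℂ) :
    rCheck Λ η (c - c') * akron (lax η x c) (lax η x c') =
      akron (lax η x c') (lax η x c) * rCheck Λ η (c - c') :=
  (rtt_iff _ _ _ _).2 (lax_rtt η x c c')

/-! ### Monodromy matrix of the inhomogeneous chain -/

/-- The monodromy matrix `T(λ) = L_{x₁}(λ - s₁) ⋯ L_{xₙ}(λ - sₙ)` over a list of sites with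
inhomogeneities `[(x₁,s₁), …, (xₙ,sₙ)]`. [cite: EsslerEtAl2005, eq. (3.B.62)] -/
def monodromy (η lam : ℂ) : List (Λ × ℂ) → Matrix (Fin 2) (Fin 2) (Op Λ 2)
  | [] => 1
  | p :: l => lax η p.1 (lam - p.2) * monodromy η lam l

/-- The monodromy matrix of the empty chain is `1`. [folklore] -/
@[simp] theorem monodromy_nil (η lam : ℂ) : monodromy (Λ := Λ) η lam [] = 1 := rfl

/-- `T_{(x,s) :: l}(λ) = L_x(λ - s) T_l(λ)`. [cite: EsslerEtAl2005, eq. (3.B.62)] -/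
@[simp] theorem monodromy_cons (η lam : ℂ) (p : Λ × ℂ) (l : List (Λ × ℂ)) :
    monodromy η lam (p :: l) = lax η p.1 (lam - p.2) * monodromy η lam l := rfl

/-- Matrix units at a site not in the list commute with all entries of the monodromy matrix.
[folklore] -/
theorem sUnit_commute_monodromy (η lam : ℂ) {y : Λ} (l : List (Λ × ℂ)) (hy : y ∉ l.map Prod.fst)
    (a b e f : Fin 2) : Commute (sUnit y a b) (monodromy η lam l e f) := by
  induction l generalizing e f with
  | nil =>
      rw [monodromy_nil, Matrix.one_apply]
      split_ifs
      · exact Commute.one_right _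
      · exact Commute.zero_right _
  | cons p l ih =>
      rw [List.map_cons, List.mem_cons, not_or] at hy
      rw [monodromy_cons, Matrix.mul_apply]
      refine Commute.sum_right _ _ _ fun r _ => Commute.mul_right ?_ (ih hy.2 _ _)
      rw [lax_apply]
      refine Commute.add_right ?_ (Commute.smul_right (sUnit_comm hy.1 _ _ _ _) _)
      split_ifs
      · exact Commute.smul_right (Commute.one_right _) _
      · exact Commute.zero_right _

/-- Entries of a Lax operator at a site outside the chain commute with the entries of the monodromy
matrix ("entries of `L`-matrices with different site indices mutually commute").
[cite: EsslerEtAl2005, after eq. (3.B.62)] -/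
theorem lax_comm_monodromy (η lam c : ℂ) {y : Λ} (l : List (Λ × ℂ)) (hy : y ∉ l.map Prod.fst)
    (a b e f : Fin 2) :
    lax η y c a b * monodromy η lam l e f = monodromy η lam l e f * lax η y c a b := by
  rw [lax_apply, add_mul, mul_add]
  congr 1
  · split_ifs <;> simp
  · rw [smul_mul_assoc, mul_smul_comm, (sUnit_commute_monodromy η lam l hy b a e f).eq]

/-- **The RTT relation** for the monodromy matrix over a list of distinct sites.
[cite: EsslerEtAl2005, eq. (3.B.63)] -/
theorem monodromy_rtt (η lam mu : ℂ) (l : List (Λ × ℂ)) (hl : (l.map Prod.fst).Nodup) :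
    rCheck Λ η (lam - mu) * akron (monodromy η lam l) (monodromy η mu l) =
      akron (monodromy η mu l) (monodromy η lam l) * rCheck Λ η (lam - mu) := by
  induction l with
  | nil => simp
  | cons p l ih =>
      rw [List.map_cons, List.nodup_cons] at hl
      have ih' := ih hl.2
      have hloc : rCheck Λ η (lam - mu) * akron (lax η p.1 (lam - p.2)) (lax η p.1 (mu - p.2)) =
          akron (lax η p.1 (mu - p.2)) (lax η p.1 (lam - p.2)) * rCheck Λ η (lam - mu) := by
        have := lax_rtt' η p.1 (lam - p.2) (mu - p.2)
        rwa [show lam - p.2 - (mu - p.2) = lam - mu by ring] at this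
      rw [monodromy_cons, monodromy_cons,
        akron_mul _ _ _ _ (fun a b c d => (lax_comm_monodromy η lam (mu - p.2) l hl.1 c d a b).symm),
        ← Matrix.mul_assoc, hloc, Matrix.mul_assoc, ih', ← Matrix.mul_assoc,
        ← akron_mul _ _ _ _ (fun a b c d => (lax_comm_monodromy η mu (lam - p.2) l hl.1 c d a b).symm)]


/-! ### The operators `A, B, C, D` and their exchange relations -/

/-- `A(λ) = T(λ)₀₀`. [cite: EsslerEtAl2005, eq. (3.B.69)] -/
def opA (η lam : ℂ) (l : List (Λ × ℂ)) : Op Λ 2 := monodromy η lam l 0 0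
/-- `B(λ) = T(λ)₀₁` (creates one down spin). [cite: EsslerEtAl2005, eq. (3.B.69)] -/
def opB (η lam : ℂ) (l : List (Λ × ℂ)) : Op Λ 2 := monodromy η lam l 0 1
/-- `C(λ) = T(λ)₁₀`. [cite: EsslerEtAl2005, eq. (3.B.69)] -/
def opC (η lam : ℂ) (l : List (Λ × ℂ)) : Op Λ 2 := monodromy η lam l 1 0
/-- `D(λ) = T(λ)₁₁`. [cite: EsslerEtAl2005, eq. (3.B.69)] -/
def opD (η lam : ℂ) (l : List (Λ × ℂ)) : Op Λ 2 := monodromy η lam l 1 1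
/-- The transfer matrix `t(λ) = tr_aux T(λ) = A(λ) + D(λ)`. [cite: EsslerEtAl2005, eq. (3.B.55)] -/
def transfer (η lam : ℂ) (l : List (Λ × ℂ)) : Op Λ 2 := opA η lam l + opD η lam l

section Relations

variable (η : ℂ) (l : List (Λ × ℂ)) (hl : (l.map Prod.fst).Nodup)
include hl

/-- The sixteen component relations of RTT. [cite: EsslerEtAl2005, eq. (3.B.63)] -/
theorem rtt_component (lam mu : ℂ) (a b e f : Fin 2) :
    η • (monodromy η lam l a e * monodromy η mu l b f) +
        (lam - mu) • (monodromy η lam l b e * monodromy η mu l a f) =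
      η • (monodromy η mu l a e * monodromy η lam l b f) +
        (lam - mu) • (monodromy η mu l a f * monodromy η lam l b e) :=
  (rtt_iff _ _ _ _).1 (monodromy_rtt η lam mu l hl) a b e f

/-- `[B(λ), B(μ)] = 0` (for `η ≠ 0`). [cite: EsslerEtAl2005, eq. (3.B.70)] -/
theorem opB_comm (hη : η ≠ 0) (lam mu : ℂ) :
    opB η lam l * opB η mu l = opB η mu l * opB η lam l := by
  have h1 := rtt_component η l hl lam mu 0 0 1 1
  have h2 := rtt_component η l hl mu lam 0 0 1 1
  simp only [opB]
  set X := monodromy η lam l 0 1 * monodromy η mu l 0 1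
  set Y := monodromy η mu l 0 1 * monodromy η lam l 0 1
  have h3 : (2 * η) • (X - Y) = 0 := by
    linear_combination (norm := module) h1 - h2
  have h4 : X - Y = 0 := by
    rcases smul_eq_zero.1 h3 with h | h
    · exact absurd h (mul_ne_zero two_ne_zero hη)
    · exact h
  exact sub_eq_zero.1 h4

/-- The `A`–`B` exchange relation
`(λ-μ) A(λ)B(μ) = (λ-μ-η) B(μ)A(λ) + η B(λ)A(μ)`. [cite: EsslerEtAl2005, eq. (3.B.71)] -/
theorem opA_opB (lam mu : ℂ) :
    (lam - mu) • (opA η lam l * opB η mu l) =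
      (lam - mu - η) • (opB η mu l * opA η lam l) + η • (opB η lam l * opA η mu l) := by
  have h1 := rtt_component η l hl lam mu 0 0 0 1
  have h2 := rtt_component η l hl mu lam 0 0 0 1
  simp only [opA, opB] at *
  set X := monodromy η lam l 0 0 * monodromy η mu l 0 1
  set Y := monodromy η mu l 0 0 * monodromy η lam l 0 1
  set p := monodromy η mu l 0 1 * monodromy η lam l 0 0 with hp
  set q := monodromy η lam l 0 1 * monodromy η mu l 0 0 with hq
  clear_value X Y p q
  obtain ⟨d, hd⟩ : ∃ d, d = lam - mu := ⟨_, rfl⟩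
  have hd' : mu - lam = -d := by rw [hd]; ring
  rw [hd'] at h2
  rw [← hd] at h1 ⊢
  by_cases hd0 : d = 0
  · have hlm : lam = mu := by rwa [hd0, eq_comm, sub_eq_zero] at hd
    subst hlm
    have hpq : p = q := by rw [hp, hq]
    simp only [hd0, zero_smul, zero_sub, neg_smul, hpq, neg_add_cancel]
  · apply smul_right_injective (Op Λ 2) hd0
    dsimp only
    linear_combination (norm := module) (d - η) • h1 - η • h2

/-- The `D`–`B` exchange relation
`(λ-μ) D(λ)B(μ) = (λ-μ+η) B(μ)D(λ) - η B(λ)D(μ)`. [cite: EsslerEtAl2005, eq. (3.B.72)] -/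
theorem opD_opB (lam mu : ℂ) :
    (lam - mu) • (opD η lam l * opB η mu l) =
      (lam - mu + η) • (opB η mu l * opD η lam l) - η • (opB η lam l * opD η mu l) := by
  have h1 := rtt_component η l hl lam mu 1 0 1 1
  have h2 := rtt_component η l hl mu lam 1 0 1 1
  simp only [opD, opB] at *
  set X := monodromy η lam l 1 1 * monodromy η mu l 0 1
  set Y := monodromy η mu l 1 1 * monodromy η lam l 0 1
  set p := monodromy η mu l 0 1 * monodromy η lam l 1 1 with hp
  set q := monodromy η lam l 0 1 * monodromy η mu l 1 1 with hq
  clear_value X Y p q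
  obtain ⟨d, hd⟩ : ∃ d, d = lam - mu := ⟨_, rfl⟩
  have hd' : mu - lam = -d := by rw [hd]; ring
  rw [hd'] at h2
  rw [← hd] at h1 ⊢
  by_cases hd0 : d = 0
  · have hlm : lam = mu := by rwa [hd0, eq_comm, sub_eq_zero] at hd
    subst hlm
    have hpq : p = q := by rw [hp, hq]
    simp only [hd0, zero_smul, zero_add, hpq, sub_self]
  · apply smul_right_injective (Op Λ 2) hd0
    dsimp only
    linear_combination (norm := module) η • h1 + (η + d) • h2

end Relations


/-! ### The reference state -/

/-- The ferromagnetic reference state `|0⟩ = |↑ ⋯ ↑⟩` (all coordinates `0 : Fin 2`), as a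
coefficient vector. [cite: EsslerEtAl2005, eq. (3.B.73)] -/
def vac : TensorIndex Λ 2 → ℂ := fun σ => if σ = 0 then 1 else 0

omit [DecidableEq Λ] in
/-- Coefficients of the reference state (definitional unfolding). [cite: EsslerEtAl2005, eq. (3.B.73)] -/
theorem vac_apply (σ : TensorIndex Λ 2) : vac σ = if σ = 0 then 1 else 0 := rfl

/-- A single-site operator acts on one coordinate (local copy of the tree lemma
`onSite_mulVec_apply` of `LiebMattisMatrixElements`, reproved to keep imports light). [folklore] -/
private theorem onSite_mulVec_apply' (x : Λ) (a : Matrix (Fin 2) (Fin 2) ℂ)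
    (ψ : TensorIndex Λ 2 → ℂ) (σ : TensorIndex Λ 2) :
    ((onSite x a : Op Λ 2) *ᵥ ψ) σ = ∑ l : Fin 2, a (σ x) l * ψ (Function.update σ x l) := by
  have hinj : Function.Injective (Function.update σ x : Fin 2 → TensorIndex Λ 2) :=
    Function.update_injective σ x
  have himg : ∀ τ : TensorIndex Λ 2, (∀ y, y ≠ x → σ y = τ y) →
      τ = Function.update σ x (τ x) := by
    intro τ h
    funext y
    by_cases hy : y = x
    · subst hy
      simp
    · rw [Function.update_of_ne hy]
      exact (h y hy).symm
  calc ((onSite x a : Op Λ 2) *ᵥ ψ) σ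
      = ∑ τ ∈ (univ : Finset (Fin 2)).image (Function.update σ x), onSite x a σ τ * ψ τ := by
        rw [mulVec, dotProduct]
        symm
        refine Finset.sum_subset (Finset.subset_univ _) fun τ _ hτ => ?_
        rw [onSite_apply, if_neg, zero_mul]
        intro h
        exact hτ (Finset.mem_image.2 ⟨τ x, mem_univ _, (himg τ h).symm⟩)
    _ = ∑ l : Fin 2, onSite x a σ (Function.update σ x l) * ψ (Function.update σ x l) := by
        rw [Finset.sum_image fun l _ l' _ h => hinj h]
    _ = ∑ l : Fin 2, a (σ x) l * ψ (Function.update σ x l) := by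
        refine Finset.sum_congr rfl fun l _ => ?_
        rw [onSite_apply, if_pos]
        · simp
        · intro y hy
          rw [Function.update_of_ne hy]

/-- `|a⟩⟨b|_x |0⟩ = 0` for `b = ↓`. [folklore] -/
theorem sUnit_mulVec_vac_of_ne_zero (x : Λ) (a : Fin 2) {b : Fin 2} (hb : b ≠ 0) :
    sUnit x a b *ᵥ vac = 0 := by
  funext σ
  rw [sUnit, onSite_mulVec_apply', Pi.zero_apply]
  refine Finset.sum_eq_zero fun l _ => ?_
  by_cases hl : l = b
  · subst hl
    rw [vac_apply, if_neg, mul_zero]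
    intro h
    have := congr_fun h x
    rw [Function.update_self, Pi.zero_apply] at this
    exact hb this
  · rw [Matrix.single_apply_of_col_ne _ _ (Ne.symm hl), zero_mul]

/-- `|↑⟩⟨↑|_x |0⟩ = |0⟩`. [folklore] -/
theorem sUnit_zero_zero_mulVec_vac (x : Λ) : sUnit x 0 0 *ᵥ vac = (vac : TensorIndex Λ 2 → ℂ) := by
  funext σ
  rw [sUnit, onSite_mulVec_apply', Fin.sum_univ_two]
  rw [Matrix.single_apply_of_col_ne (0 : Fin 2) (σ x) (j := 0) (j' := 1) (by decide) (1 : ℂ),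
    zero_mul, add_zero, Matrix.single_apply]
  by_cases h0 : σ x = 0
  · rw [if_pos ⟨h0.symm, rfl⟩, one_mul]
    congr 1
    rw [← h0, Function.update_eq_self]
  · rw [if_neg (fun h => h0 h.1.symm), zero_mul, vac_apply, if_neg]
    intro h
    exact h0 (by rw [h]; rfl)

/-- `L_x(c)₀₀ |0⟩ = (c + η)|0⟩`. [cite: EsslerEtAl2005, eq. (3.B.73)] -/
theorem lax_zero_zero_mulVec_vac (η : ℂ) (x : Λ) (c : ℂ) :
    lax η x c 0 0 *ᵥ vac = (c + η) • (vac : TensorIndex Λ 2 → ℂ) := by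
  rw [lax_apply, if_pos rfl, add_mulVec, smul_mulVec, one_mulVec, smul_mulVec,
    sUnit_zero_zero_mulVec_vac, add_smul]

/-- `L_x(c)₁₁ |0⟩ = c|0⟩`. [cite: EsslerEtAl2005, eq. (3.B.73)] -/
theorem lax_one_one_mulVec_vac (η : ℂ) (x : Λ) (c : ℂ) :
    lax η x c 1 1 *ᵥ vac = c • (vac : TensorIndex Λ 2 → ℂ) := by
  rw [lax_apply, if_pos rfl, add_mulVec, smul_mulVec, one_mulVec, smul_mulVec,
    sUnit_mulVec_vac_of_ne_zero x 1 one_ne_zero, smul_zero, add_zero]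

/-- `L_x(c)₁₀ = η |↑⟩⟨↓|_x` (`= 2b(2λ)σ⁺ₓ` up to normalisation). [cite: EsslerEtAl2005, eq. (3.B.60)] -/
theorem lax_one_zero (η : ℂ) (x : Λ) (c : ℂ) : lax η x c 1 0 = η • sUnit x 0 1 := by
  rw [lax_apply, if_neg (by decide), zero_add]

/-- `L_x(c)₀₁ = η |↓⟩⟨↑|_x` (`= 2b(2λ)σ⁻ₓ` up to normalisation). [cite: EsslerEtAl2005, eq. (3.B.60)] -/
theorem lax_zero_one (η : ℂ) (x : Λ) (c : ℂ) : lax η x c 0 1 = η • sUnit x 1 0 := by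
  rw [lax_apply, if_neg (by decide), zero_add]

/-- Vacuum eigenvalue of `A`: `a(λ) = ∏ (λ - s_x + η)`. [cite: EsslerEtAl2005, eq. (3.B.74)] -/
def aEig (η lam : ℂ) (l : List (Λ × ℂ)) : ℂ := (l.map fun p => lam - p.2 + η).prod

/-- Vacuum eigenvalue of `D`: `d(λ) = ∏ (λ - s_x)`. [cite: EsslerEtAl2005, eq. (3.B.74)] -/
def dEig (lam : ℂ) (l : List (Λ × ℂ)) : ℂ := (l.map fun p => lam - p.2).prod

omit [Fintype Λ] [DecidableEq Λ] in
/-- `a(λ) = 1` for the empty chain. [folklore] -/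
@[simp] theorem aEig_nil (η lam : ℂ) : aEig η lam ([] : List (Λ × ℂ)) = 1 := rfl
omit [Fintype Λ] [DecidableEq Λ] in
/-- `a(λ)` gains the factor `λ - s + η` per site. [cite: EsslerEtAl2005, eq. (3.B.74)] -/
@[simp] theorem aEig_cons (η lam : ℂ) (p : Λ × ℂ) (l : List (Λ × ℂ)) :
    aEig η lam (p :: l) = (lam - p.2 + η) * aEig η lam l := rfl
omit [Fintype Λ] [DecidableEq Λ] in
/-- `d(λ) = 1` for the empty chain. [folklore] -/
@[simp] theorem dEig_nil (lam : ℂ) : dEig lam ([] : List (Λ × ℂ)) = 1 := rfl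
omit [Fintype Λ] [DecidableEq Λ] in
/-- `d(λ)` gains the factor `λ - s` per site. [cite: EsslerEtAl2005, eq. (3.B.74)] -/
@[simp] theorem dEig_cons (lam : ℂ) (p : Λ × ℂ) (l : List (Λ × ℂ)) :
    dEig lam (p :: l) = (lam - p.2) * dEig lam l := rfl

/-- Entries of `L T`: `(L T)_{ab} = L_{a0} T_{0b} + L_{a1} T_{1b}`. [folklore] -/
theorem monodromy_cons_apply (η lam : ℂ) (p : Λ × ℂ) (l : List (Λ × ℂ)) (a b : Fin 2) :
    monodromy η lam (p :: l) a b =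
      lax η p.1 (lam - p.2) a 0 * monodromy η lam l 0 b +
        lax η p.1 (lam - p.2) a 1 * monodromy η lam l 1 b := by
  rw [monodromy_cons, Matrix.mul_apply, Fin.sum_univ_two]

/-- `A(λ)|0⟩ = a(λ)|0⟩` and `C(λ)|0⟩ = 0`. [cite: EsslerEtAl2005, eqs. (3.B.73)–(3.B.74)] -/
theorem opA_opC_vac (η lam : ℂ) (l : List (Λ × ℂ)) :
    opA η lam l *ᵥ vac = aEig η lam l • (vac : TensorIndex Λ 2 → ℂ) ∧ opC η lam l *ᵥ vac = 0 := by
  induction l with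
  | nil => simp [opA, opC]
  | cons p l ih =>
      obtain ⟨ihA, ihC⟩ := ih
      simp only [opA, opC] at ihA ihC ⊢
      constructor
      · rw [monodromy_cons_apply, add_mulVec, ← mulVec_mulVec, ← mulVec_mulVec, ihA, ihC,
          mulVec_zero, add_zero, mulVec_smul, lax_zero_zero_mulVec_vac, smul_smul, aEig_cons,
          mul_comm]
      · rw [monodromy_cons_apply, add_mulVec, ← mulVec_mulVec, ← mulVec_mulVec, ihA, ihC,
          mulVec_zero, add_zero, mulVec_smul, lax_one_zero, smul_mulVec,
          sUnit_mulVec_vac_of_ne_zero _ _ one_ne_zero, smul_zero, smul_zero]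

/-- `A(λ)|0⟩ = a(λ)|0⟩`, `a(λ) = ∏ (λ - s_x + η)`. [cite: EsslerEtAl2005, eq. (3.B.74)] -/
theorem opA_vac (η lam : ℂ) (l : List (Λ × ℂ)) :
    opA η lam l *ᵥ vac = aEig η lam l • (vac : TensorIndex Λ 2 → ℂ) := (opA_opC_vac η lam l).1

/-- `C(λ)|0⟩ = 0`. [cite: EsslerEtAl2005, eq. (3.B.73)] -/
theorem opC_vac (η lam : ℂ) (l : List (Λ × ℂ)) : opC η lam l *ᵥ vac = 0 := (opA_opC_vac η lam l).2

/-- `|↑⟩⟨↓|_y B(λ)|0⟩ = 0` for a site `y` outside the chain. [folklore] -/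
theorem sUnit_zero_one_mulVec_opB_vac (η lam : ℂ) {y : Λ} (l : List (Λ × ℂ))
    (hy : y ∉ l.map Prod.fst) : sUnit y 0 1 *ᵥ (opB η lam l *ᵥ vac) = 0 := by
  rw [mulVec_mulVec, opB, (sUnit_commute_monodromy η lam l hy 0 1 0 1).eq, ← mulVec_mulVec,
    sUnit_mulVec_vac_of_ne_zero _ _ one_ne_zero, mulVec_zero]

/-- `D(λ)|0⟩ = d(λ)|0⟩`. [cite: EsslerEtAl2005, eq. (3.B.74)] -/
theorem opD_vac (η lam : ℂ) (l : List (Λ × ℂ)) (hl : (l.map Prod.fst).Nodup) :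
    opD η lam l *ᵥ vac = dEig lam l • (vac : TensorIndex Λ 2 → ℂ) := by
  induction l with
  | nil => simp [opD]
  | cons p l ih =>
      rw [List.map_cons, List.nodup_cons] at hl
      simp only [opD] at ih ⊢
      rw [monodromy_cons_apply, add_mulVec, ← mulVec_mulVec, ← mulVec_mulVec, ih hl.2, lax_one_zero,
        smul_mulVec, ← opB, sUnit_zero_one_mulVec_opB_vac η lam l hl.1, smul_zero, zero_add,
        mulVec_smul, lax_one_one_mulVec_vac, smul_smul, dEig_cons, mul_comm]


/-! ### Algebraic Bethe ansatz: action of `A(λ)`, `D(λ)` on `B`-strings -/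

/-- The string of creation operators `B(λ₁) ⋯ B(λ_M)`. [cite: EsslerEtAl2005, eq. (3.B.75)] -/
def bString (η : ℂ) (l : List (Λ × ℂ)) (lams : List ℂ) : Op Λ 2 :=
  (lams.map fun mu => opB η mu l).prod

/-- The empty `B`-string is `1`. [folklore] -/
@[simp] theorem bString_nil (η : ℂ) (l : List (Λ × ℂ)) : bString η l [] = 1 := by
  simp [bString]

/-- `𝔅(μ :: λ⃗) = B(μ) 𝔅(λ⃗)`. [cite: EsslerEtAl2005, eq. (3.B.75)] -/
@[simp] theorem bString_cons (η : ℂ) (l : List (Λ × ℂ)) (mu : ℂ) (lams : List ℂ) :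
    bString η l (mu :: lams) = opB η mu l * bString η l lams := by
  simp [bString]

/-- The "wanted" coefficient of `A(λ)` on a `B`-string:
`a(λ) ∏_ν (λ - ν - η)/(λ - ν)`. [cite: EsslerEtAl2005, eq. (3.B.76)] -/
def coefA (η : ℂ) (l : List (Λ × ℂ)) (lam : ℂ) (lams : List ℂ) : ℂ :=
  aEig η lam l * (lams.map fun nu => (lam - nu - η) / (lam - nu)).prod

/-- The "wanted" coefficient of `D(λ)` on a `B`-string:
`d(λ) ∏_ν (λ - ν + η)/(λ - ν)`. [cite: EsslerEtAl2005, eq. (3.B.77)] -/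
def coefD (η : ℂ) (l : List (Λ × ℂ)) (lam : ℂ) (lams : List ℂ) : ℂ :=
  dEig lam l * (lams.map fun nu => (lam - nu + η) / (lam - nu)).prod

omit [Fintype Λ] [DecidableEq Λ] in
/-- `coefA` of the empty string is `a(λ)`. [folklore] -/
@[simp] theorem coefA_nil (η : ℂ) (l : List (Λ × ℂ)) (lam : ℂ) : coefA η l lam [] = aEig η lam l := by
  simp [coefA]

omit [Fintype Λ] [DecidableEq Λ] in
/-- `coefA` gains the factor `(λ - μ - η)/(λ - μ)` per rapidity. [cite: EsslerEtAl2005, eq. (3.B.76)] -/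
@[simp] theorem coefA_cons (η : ℂ) (l : List (Λ × ℂ)) (lam mu : ℂ) (lams : List ℂ) :
    coefA η l lam (mu :: lams) = (lam - mu - η) / (lam - mu) * coefA η l lam lams := by
  simp only [coefA, List.map_cons, List.prod_cons]
  ring

omit [Fintype Λ] [DecidableEq Λ] in
/-- `coefD` of the empty string is `d(λ)`. [folklore] -/
@[simp] theorem coefD_nil (η : ℂ) (l : List (Λ × ℂ)) (lam : ℂ) : coefD η l lam [] = dEig lam l := by
  simp [coefD]

omit [Fintype Λ] [DecidableEq Λ] in
/-- `coefD` gains the factor `(λ - μ + η)/(λ - μ)` per rapidity. [cite: EsslerEtAl2005, eq. (3.B.77)] -/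
@[simp] theorem coefD_cons (η : ℂ) (l : List (Λ × ℂ)) (lam mu : ℂ) (lams : List ℂ) :
    coefD η l lam (mu :: lams) = (lam - mu + η) / (lam - mu) * coefD η l lam lams := by
  simp only [coefD, List.map_cons, List.prod_cons]
  ring

section ABA

variable (η : ℂ) (hη : η ≠ 0) (l : List (Λ × ℂ)) (hl : (l.map Prod.fst).Nodup)
include hη hl

omit hη in
/-- Divided form of the `A`–`B` exchange relation. [cite: EsslerEtAl2005, eq. (3.B.71)] -/
theorem opA_mul_opB {lam mu : ℂ} (h : lam ≠ mu) :
    opA η lam l * opB η mu l =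
      ((lam - mu - η) / (lam - mu)) • (opB η mu l * opA η lam l) +
        (η / (lam - mu)) • (opB η lam l * opA η mu l) := by
  have hd : lam - mu ≠ 0 := sub_ne_zero.2 h
  apply smul_right_injective (Op Λ 2) hd
  dsimp only
  rw [opA_opB η l hl lam mu, smul_add, smul_smul, smul_smul, mul_div_cancel₀ _ hd,
    mul_div_cancel₀ _ hd]

omit hη in
/-- Divided form of the `D`–`B` exchange relation. [cite: EsslerEtAl2005, eq. (3.B.72)] -/
theorem opD_mul_opB {lam mu : ℂ} (h : lam ≠ mu) :
    opD η lam l * opB η mu l =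
      ((lam - mu + η) / (lam - mu)) • (opB η mu l * opD η lam l) -
        (η / (lam - mu)) • (opB η lam l * opD η mu l) := by
  have hd : lam - mu ≠ 0 := sub_ne_zero.2 h
  apply smul_right_injective (Op Λ 2) hd
  dsimp only
  rw [opD_opB η l hl lam mu, smul_sub, smul_smul, smul_smul, mul_div_cancel₀ _ hd,
    mul_div_cancel₀ _ hd]

omit [Fintype Λ] [DecidableEq Λ] hη hl in
/-- Scalar identity behind the recursion for the unwanted coefficients of `A`. [folklore] -/
theorem coefA_recursion_identity {lam mu r : ℂ} (h1 : lam ≠ mu) (h2 : lam ≠ r) (h3 : mu ≠ r) (C : ℂ) :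
    (lam - mu - η) / (lam - mu) * (η / (lam - r) * C) + η / (lam - mu) * (η / (mu - r) * C) =
      η / (lam - r) * ((r - mu - η) / (r - mu) * C) := by
  have h1' : lam - mu ≠ 0 := sub_ne_zero.2 h1
  have h2' : lam - r ≠ 0 := sub_ne_zero.2 h2
  have h3' : mu - r ≠ 0 := sub_ne_zero.2 h3
  have h3'' : r - mu ≠ 0 := sub_ne_zero.2 (Ne.symm h3)
  field_simp
  ring

/-- **Off-shell action of `A(λ)` on a `B`-string** (Essler et al. (3.B.76), (3.B.79)):
`A(λ) 𝔅(λ⃗)|0⟩ = a(λ)∏_j (λ-λ_j-η)/(λ-λ_j) 𝔅(λ⃗)|0⟩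
  + Σ_j η/(λ-λ_j) a(λ_j) ∏_{k≠j} (λ_j-λ_k-η)/(λ_j-λ_k) B(λ) 𝔅(λ⃗∖λ_j)|0⟩`.
[cite: EsslerEtAl2005, eqs. (3.B.76), (3.B.79)] -/
theorem opA_bString_vac (lam : ℂ) (lams : List ℂ) (hnd : lams.Nodup) (hlam : lam ∉ lams) :
    opA η lam l *ᵥ (bString η l lams *ᵥ vac) =
      coefA η l lam lams • (bString η l lams *ᵥ vac) +
        ∑ j ∈ Finset.range lams.length,
          (η / (lam - lams.getD j 0) * coefA η l (lams.getD j 0) (lams.eraseIdx j)) •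
            (opB η lam l *ᵥ (bString η l (lams.eraseIdx j) *ᵥ vac)) := by
  induction lams generalizing lam with
  | nil =>
      rw [bString_nil, one_mulVec, opA_vac, List.length_nil, Finset.range_zero, Finset.sum_empty,
        add_zero, coefA_nil]
  | cons mu rest ih =>
      rw [List.nodup_cons] at hnd
      rw [List.mem_cons, not_or] at hlam
      have ihl := ih lam hnd.2 hlam.2
      have ihm := ih mu hnd.2 hnd.1
      set w := bString η l rest *ᵥ vac with hw
      have hcomm : ∀ v : TensorIndex Λ 2 → ℂ,
          opB η mu l *ᵥ (opB η lam l *ᵥ v) = opB η lam l *ᵥ (opB η mu l *ᵥ v) := by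
        intro v
        rw [mulVec_mulVec, mulVec_mulVec, opB_comm η l hl hη]
      -- Step 1: exchange relation
      have key : opA η lam l *ᵥ (bString η l (mu :: rest) *ᵥ vac) =
          ((lam - mu - η) / (lam - mu)) • (opB η mu l *ᵥ (opA η lam l *ᵥ w)) +
            (η / (lam - mu)) • (opB η lam l *ᵥ (opA η mu l *ᵥ w)) := by
        rw [bString_cons, ← mulVec_mulVec, mulVec_mulVec _ (opA η lam l),
          opA_mul_opB η l hl hlam.1, add_mulVec, smul_mulVec, smul_mulVec, ← mulVec_mulVec,
          ← mulVec_mulVec]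
      -- Step 2: insert the induction hypotheses and expand
      rw [key, ihl, ihm]
      simp only [mulVec_add, mulVec_smul, Matrix.mulVec_sum, smul_add, Finset.smul_sum, smul_smul,
        hcomm]
      -- Step 3: the right-hand side
      rw [List.length_cons, Finset.sum_range_succ', List.getD_cons_zero, List.eraseIdx_cons_zero,
        coefA_cons, bString_cons, ← mulVec_mulVec]
      simp only [List.getD_cons_succ, List.eraseIdx_cons_succ, coefA_cons, bString_cons,
        ← mulVec_mulVec]
      -- Step 4: compare
      rw [add_add_add_comm, ← Finset.sum_add_distrib, add_right_comm, add_assoc]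
      congr 2
      · refine Finset.sum_congr rfl fun x hx => ?_
        rw [← add_smul]
        congr 1
        have hxr : rest.getD x 0 ∈ rest := by
          rw [Finset.mem_range] at hx
          rw [List.getD_eq_getElem rest (0 : ℂ) hx]
          exact List.getElem_mem hx
        have h2 : lam ≠ rest.getD x 0 := fun h => hlam.2 (h ▸ hxr)
        have h3 : mu ≠ rest.getD x 0 := fun h => hnd.1 (h ▸ hxr)
        exact coefA_recursion_identity η hlam.1 h2 h3 _

omit [Fintype Λ] [DecidableEq Λ] hη hl in
/-- Scalar identity behind the recursion for the unwanted coefficients of `D`. [folklore] -/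
theorem coefD_recursion_identity {lam mu r : ℂ} (h1 : lam ≠ mu) (h2 : lam ≠ r) (h3 : mu ≠ r) (C : ℂ) :
    (lam - mu + η) / (lam - mu) * (-η / (lam - r) * C) + -η / (lam - mu) * (-η / (mu - r) * C) =
      -η / (lam - r) * ((r - mu + η) / (r - mu) * C) := by
  have h1' : lam - mu ≠ 0 := sub_ne_zero.2 h1
  have h2' : lam - r ≠ 0 := sub_ne_zero.2 h2
  have h3' : mu - r ≠ 0 := sub_ne_zero.2 h3
  have h3'' : r - mu ≠ 0 := sub_ne_zero.2 (Ne.symm h3)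
  field_simp
  ring

omit hη in
/-- Divided form of the `D`–`B` exchange relation, additive version.
[cite: EsslerEtAl2005, eq. (3.B.72)] -/
theorem opD_mul_opB' {lam mu : ℂ} (h : lam ≠ mu) :
    opD η lam l * opB η mu l =
      ((lam - mu + η) / (lam - mu)) • (opB η mu l * opD η lam l) +
        (-η / (lam - mu)) • (opB η lam l * opD η mu l) := by
  rw [opD_mul_opB η l hl h, sub_eq_add_neg, ← neg_smul, neg_div]

/-- **Off-shell action of `D(λ)` on a `B`-string** (Essler et al. (3.B.77), (3.B.80)):
`D(λ) 𝔅(λ⃗)|0⟩ = d(λ)∏_j (λ-λ_j+η)/(λ-λ_j) 𝔅(λ⃗)|0⟩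
  - Σ_j η/(λ-λ_j) d(λ_j) ∏_{k≠j} (λ_j-λ_k+η)/(λ_j-λ_k) B(λ) 𝔅(λ⃗∖λ_j)|0⟩`.
[cite: EsslerEtAl2005, eqs. (3.B.77), (3.B.80)] -/
theorem opD_bString_vac (lam : ℂ) (lams : List ℂ) (hnd : lams.Nodup) (hlam : lam ∉ lams) :
    opD η lam l *ᵥ (bString η l lams *ᵥ vac) =
      coefD η l lam lams • (bString η l lams *ᵥ vac) +
        ∑ j ∈ Finset.range lams.length,
          (-η / (lam - lams.getD j 0) * coefD η l (lams.getD j 0) (lams.eraseIdx j)) •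
            (opB η lam l *ᵥ (bString η l (lams.eraseIdx j) *ᵥ vac)) := by
  induction lams generalizing lam with
  | nil =>
      rw [bString_nil, one_mulVec, opD_vac η lam l hl, List.length_nil, Finset.range_zero,
        Finset.sum_empty, add_zero, coefD_nil]
  | cons mu rest ih =>
      rw [List.nodup_cons] at hnd
      rw [List.mem_cons, not_or] at hlam
      have ihl := ih lam hnd.2 hlam.2
      have ihm := ih mu hnd.2 hnd.1
      set w := bString η l rest *ᵥ vac with hw
      have hcomm : ∀ v : TensorIndex Λ 2 → ℂ,
          opB η mu l *ᵥ (opB η lam l *ᵥ v) = opB η lam l *ᵥ (opB η mu l *ᵥ v) := by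
        intro v
        rw [mulVec_mulVec, mulVec_mulVec, opB_comm η l hl hη]
      have key : opD η lam l *ᵥ (bString η l (mu :: rest) *ᵥ vac) =
          ((lam - mu + η) / (lam - mu)) • (opB η mu l *ᵥ (opD η lam l *ᵥ w)) +
            (-η / (lam - mu)) • (opB η lam l *ᵥ (opD η mu l *ᵥ w)) := by
        rw [bString_cons, ← mulVec_mulVec, mulVec_mulVec _ (opD η lam l),
          opD_mul_opB' η l hl hlam.1, add_mulVec, smul_mulVec, smul_mulVec, ← mulVec_mulVec,
          ← mulVec_mulVec]
      rw [key, ihl, ihm]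
      simp only [mulVec_add, mulVec_smul, Matrix.mulVec_sum, smul_add, Finset.smul_sum, smul_smul,
        hcomm]
      rw [List.length_cons, Finset.sum_range_succ', List.getD_cons_zero, List.eraseIdx_cons_zero,
        coefD_cons, bString_cons, ← mulVec_mulVec]
      simp only [List.getD_cons_succ, List.eraseIdx_cons_succ, coefD_cons, bString_cons,
        ← mulVec_mulVec]
      rw [add_add_add_comm, ← Finset.sum_add_distrib, add_right_comm, add_assoc]
      congr 2
      · refine Finset.sum_congr rfl fun x hx => ?_
        rw [← add_smul]
        congr 1
        have hxr : rest.getD x 0 ∈ rest := by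
          rw [Finset.mem_range] at hx
          rw [List.getD_eq_getElem rest (0 : ℂ) hx]
          exact List.getElem_mem hx
        have h2 : lam ≠ rest.getD x 0 := fun h => hlam.2 (h ▸ hxr)
        have h3 : mu ≠ rest.getD x 0 := fun h => hnd.1 (h ▸ hxr)
        exact coefD_recursion_identity η hlam.1 h2 h3 _

/-- **Algebraic Bethe ansatz for the inhomogeneous XXX chain** (Essler et al. 2005,
(3.B.81)–(3.B.85)): if the spin rapidities `λ₁, …, λ_M` (pairwise distinct) satisfy the Bethe
equations in the form `a(λ_j) ∏_{k≠j} (λ_j-λ_k-η)/(λ_j-λ_k) = d(λ_j) ∏_{k≠j} (λ_j-λ_k+η)/(λ_j-λ_k)`,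
then `B(λ₁)⋯B(λ_M)|0⟩` is an eigenvector of the transfer matrix `t(λ) = A(λ) + D(λ)` for every
`λ ∉ {λ_j}`, with eigenvalue
`Λ(λ) = a(λ) ∏_j (λ-λ_j-η)/(λ-λ_j) + d(λ) ∏_j (λ-λ_j+η)/(λ-λ_j)`.
[cite: EsslerEtAl2005, eqs. (3.B.81)–(3.B.85)] -/
theorem transfer_bString_vac (lam : ℂ) (lams : List ℂ) (hnd : lams.Nodup) (hlam : lam ∉ lams)
    (hBethe : ∀ j < lams.length,
      coefA η l (lams.getD j 0) (lams.eraseIdx j) = coefD η l (lams.getD j 0) (lams.eraseIdx j)) :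
    transfer η lam l *ᵥ (bString η l lams *ᵥ vac) =
      (coefA η l lam lams + coefD η l lam lams) • (bString η l lams *ᵥ vac) := by
  rw [transfer, add_mulVec, opA_bString_vac η hη l hl lam lams hnd hlam,
    opD_bString_vac η hη l hl lam lams hnd hlam, add_add_add_comm, ← Finset.sum_add_distrib,
    add_smul, add_eq_left]
  refine Finset.sum_eq_zero fun j hj => ?_
  rw [← add_smul, hBethe j (Finset.mem_range.1 hj), neg_div, neg_mul, add_neg_cancel, zero_smul]

end ABA

/-! ### The Bethe equations in polynomial form -/

omit [Fintype Λ] [DecidableEq Λ] in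
/-- `∏ (f/g) = (∏ f)/(∏ g)` over a list. [folklore] -/
private theorem list_prod_map_div (lams : List ℂ) (f g : ℂ → ℂ) :
    (lams.map fun nu => f nu / g nu).prod = (lams.map f).prod / (lams.map g).prod := by
  induction lams with
  | nil => simp
  | cons mu rest ih => simp only [List.map_cons, List.prod_cons, ih]; ring

omit [Fintype Λ] [DecidableEq Λ] in
/-- `∏_{ν ∈ λ⃗} (r - ν) ≠ 0` when `r ∉ λ⃗`. [folklore] -/
private theorem list_prod_map_sub_ne_zero (r : ℂ) (lams : List ℂ) (h : r ∉ lams) :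
    (lams.map fun nu => r - nu).prod ≠ 0 := by
  induction lams with
  | nil => simp
  | cons mu rest ih =>
      rw [List.mem_cons, not_or] at h
      rw [List.map_cons, List.prod_cons]
      exact mul_ne_zero (sub_ne_zero.2 h.1) (ih h.2)

omit [Fintype Λ] [DecidableEq Λ] in
/-- The divided Bethe equations `coefA = coefD` from the polynomial ("cleared") Bethe equations
`a(λ_j) ∏_{k≠j} (λ_j - λ_k - η) = d(λ_j) ∏_{k≠j} (λ_j - λ_k + η)` (Essler et al. (3.B.82)–(3.B.83)),
for pairwise distinct rapidities. [cite: EsslerEtAl2005, eqs. (3.B.82)–(3.B.83)] -/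
theorem coefA_eq_coefD_of_bethe (η : ℂ) (l : List (Λ × ℂ)) {r : ℂ} {rest : List ℂ} (hr : r ∉ rest)
    (h : aEig η r l * (rest.map fun nu => r - nu - η).prod =
      dEig r l * (rest.map fun nu => r - nu + η).prod) :
    coefA η l r rest = coefD η l r rest := by
  have hne := list_prod_map_sub_ne_zero r rest hr
  rw [coefA, coefD, list_prod_map_div, list_prod_map_div, mul_div_assoc', mul_div_assoc', h]




/-! ### Exchange of adjacent inhomogeneities (the intertwiner `v + η P_{xy}`) -/

/-- The transposition operator `P_{xy} = Σ_{a,b} |a⟩⟨b|_x |b⟩⟨a|_y` of the spins at two sites.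
[cite: EsslerEtAl2005, eq. (3.B.50)] -/
def swapOp (x y : Λ) : Op Λ 2 := ∑ a, ∑ b, sUnit x a b * sUnit y b a

/-- `P_{xy} = P_{yx}`. [folklore] -/
theorem swapOp_comm {x y : Λ} (hxy : x ≠ y) : swapOp x y = swapOp y x := by
  unfold swapOp
  rw [Finset.sum_comm]
  refine Finset.sum_congr rfl fun a _ => Finset.sum_congr rfl fun b _ => ?_
  rw [sUnit_comm hxy]

/-- `Π_x Π_y = P_{xy} Π_x` in components: `Σ_r |r⟩⟨a|_x |b⟩⟨r|_y = P_{xy} |b⟩⟨a|_x`. [folklore] -/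
theorem sum_sUnit_mul_sUnit {x y : Λ} (hxy : x ≠ y) (a b : Fin 2) :
    ∑ r, sUnit x r a * sUnit y b r = swapOp x y * sUnit x b a := by
  unfold swapOp
  rw [Finset.sum_mul]
  refine Finset.sum_congr rfl fun p _ => ?_
  rw [Finset.sum_mul, Fin.sum_univ_two, mul_assoc, mul_assoc, ← sUnit_comm hxy, ← sUnit_comm hxy,
    ← mul_assoc, ← mul_assoc, sUnit_mul_sUnit, sUnit_mul_sUnit]
  rcases Fin.exists_fin_two.mp ⟨b, rfl⟩ with rfl | rfl <;> simp

/-- `P_{xy} |b⟩⟨a|_x = |b⟩⟨a|_y P_{xy}`. [folklore] -/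
theorem swapOp_mul_sUnit {x y : Λ} (hxy : x ≠ y) (a b : Fin 2) :
    swapOp x y * sUnit x b a = sUnit y b a * swapOp x y := by
  rw [← sum_sUnit_mul_sUnit hxy, swapOp, Finset.mul_sum]
  -- RHS: Σ_p Σ_q e_y^{ba} e_x^{pq} e_y^{qp} = Σ_p Σ_q e_x^{pq} (e_y^{ba} e_y^{qp}) = Σ_p e_x^{pa} e_y^{bp}
  refine Finset.sum_congr rfl fun p _ => ?_
  rw [Finset.mul_sum, Fin.sum_univ_two, ← mul_assoc, ← mul_assoc, ← sUnit_comm hxy, ← sUnit_comm hxy,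
    mul_assoc, mul_assoc, sUnit_mul_sUnit, sUnit_mul_sUnit]
  rcases Fin.exists_fin_two.mp ⟨a, rfl⟩ with rfl | rfl <;> simp

/-- Entries of the product of two Lax operators at distinct sites:
`(L_x(c) L_y(c'))_{ab} = c c' δ_{ab} + c η |b⟩⟨a|_y + c' η |b⟩⟨a|_x + η² P_{xy} |b⟩⟨a|_x`. [folklore] -/
theorem lax_mul_lax_apply (η : ℂ) {x y : Λ} (hxy : x ≠ y) (c c' : ℂ) (a b : Fin 2) :
    (lax η x c * lax η y c') a b =
      (if a = b then (c * c') • (1 : Op Λ 2) else 0) + (c * η) • sUnit y b a + (c' * η) • sUnit x b a +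
        (η * η) • (swapOp x y * sUnit x b a) := by
  rw [Matrix.mul_apply, ← sum_sUnit_mul_sUnit hxy]
  simp only [lax_apply, add_mul, mul_add, ite_mul, mul_ite, zero_mul, mul_zero, smul_mul_assoc,
    mul_smul_comm, one_mul, mul_one, Finset.sum_add_distrib, Finset.sum_ite_eq', Finset.mem_univ,
    if_true, Finset.smul_sum]
  rcases Fin.exists_fin_two.mp ⟨a, rfl⟩ with rfl | rfl <;>
  rcases Fin.exists_fin_two.mp ⟨b, rfl⟩ with rfl | rfl <;>
  · simp [Fin.sum_univ_two, smul_smul, mul_comm]; module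

/-- **Quantum-space Yang–Baxter equation** (exchange of two adjacent Lax operators by the
intertwiner `(c' - c) + η P_{xy}`). [cite: EsslerEtAl2005, eq. (3.B.49)] -/
theorem lax_lax_swap (η : ℂ) {x y : Λ} (hxy : x ≠ y) (c c' : ℂ) (a b : Fin 2) :
    (lax η x c * lax η y c') a b * ((c' - c) • (1 : Op Λ 2) + η • swapOp x y) =
      ((c' - c) • (1 : Op Λ 2) + η • swapOp x y) * (lax η y c' * lax η x c) a b := by
  rw [lax_mul_lax_apply η hxy, lax_mul_lax_apply η (Ne.symm hxy), ← swapOp_comm hxy]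
  have R2 : swapOp x y * sUnit x b a = sUnit y b a * swapOp x y := swapOp_mul_sUnit hxy a b
  have R2' : swapOp x y * sUnit y b a = sUnit x b a * swapOp x y := by
    rw [swapOp_comm hxy, swapOp_mul_sUnit (Ne.symm hxy), ← swapOp_comm hxy]
  set P := swapOp x y
  set ex := sUnit x b a
  set ey := sUnit y b a
  -- expand (`simp` also rewrites with the local relations `R2`, `R2'` once `P * ex`, `P * ey` appear)
  simp only [add_mul, mul_add, ite_mul, mul_ite, zero_mul, mul_zero, smul_mul_assoc, mul_smul_comm,
    one_mul, mul_one, mul_assoc, R2, R2']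
  rw [← mul_assoc P ex P, R2, mul_assoc]
  split_ifs <;> module

/-- Entries of the monodromy matrix over a list avoiding `x, y` commute with `P_{xy}`. [folklore] -/
theorem swapOp_commute_monodromy (η lam : ℂ) {x y : Λ} (l : List (Λ × ℂ))
    (hx : x ∉ l.map Prod.fst) (hy : y ∉ l.map Prod.fst) (e f : Fin 2) :
    Commute (swapOp x y) (monodromy η lam l e f) := by
  unfold swapOp
  refine Commute.sum_left _ _ _ fun a _ => Commute.sum_left _ _ _ fun b _ => ?_
  exact Commute.mul_left (sUnit_commute_monodromy η lam l hx _ _ _ _)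
    (sUnit_commute_monodromy η lam l hy _ _ _ _)

/-- The intertwiner `R = v + η P_{xy}` commutes with Lax entries at other sites. [folklore] -/
theorem lax_comm_swapR (η : ℂ) {x y z : Λ} (hzx : z ≠ x) (hzy : z ≠ y) (v c : ℂ) (a b : Fin 2) :
    lax η z c a b * (v • (1 : Op Λ 2) + η • swapOp x y) =
      (v • (1 : Op Λ 2) + η • swapOp x y) * lax η z c a b := by
  have hc : Commute (sUnit z b a) (swapOp x y) := by
    unfold swapOp
    refine Commute.sum_right _ _ _ fun p _ => Commute.sum_right _ _ _ fun q _ => ?_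
    exact Commute.mul_right (sUnit_comm hzx _ _ _ _) (sUnit_comm hzy _ _ _ _)
  rw [lax_apply]
  simp only [add_mul, mul_add, ite_mul, mul_ite, zero_mul, mul_zero, smul_mul_assoc, mul_smul_comm,
    one_mul, mul_one, hc.eq]
  split_ifs <;> module

/-- The intertwiner commutes with monodromy entries over lists avoiding `x, y`. [folklore] -/
theorem monodromy_comm_swapR (η lam : ℂ) {x y : Λ} (l : List (Λ × ℂ))
    (hx : x ∉ l.map Prod.fst) (hy : y ∉ l.map Prod.fst) (v : ℂ) (e f : Fin 2) :
    monodromy η lam l e f * (v • (1 : Op Λ 2) + η • swapOp x y) =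
      (v • (1 : Op Λ 2) + η • swapOp x y) * monodromy η lam l e f := by
  rw [mul_add, add_mul, mul_smul_comm, smul_mul_assoc, mul_one, one_mul, mul_smul_comm, smul_mul_assoc,
    (swapOp_commute_monodromy η lam l hx hy e f).eq]

/-- **Exchange of adjacent inhomogeneities.** For a chain `l₁ ++ (x,s) :: (y,s') :: l₂` of distinct
sites, `T(λ)_{ab} R = R T'(λ)_{ab}` with `R = (s - s') + η P_{xy}` and `T'` the monodromy matrix of
the chain with `(x,s)` and `(y,s')` interchanged (Essler et al. (3.B.31) in algebraic form).
[cite: EsslerEtAl2005, eq. (3.B.31)] -/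
theorem monodromy_swap (η lam : ℂ) {x y : Λ} {s s' : ℂ} (l₁ l₂ : List (Λ × ℂ))
    (hnd : ((l₁ ++ (x, s) :: (y, s') :: l₂).map Prod.fst).Nodup) (a b : Fin 2) :
    monodromy η lam (l₁ ++ (x, s) :: (y, s') :: l₂) a b * ((s - s') • (1 : Op Λ 2) + η • swapOp x y) =
      ((s - s') • (1 : Op Λ 2) + η • swapOp x y) *
        monodromy η lam (l₁ ++ (y, s') :: (x, s) :: l₂) a b := by
  induction l₁ generalizing a b with
  | nil =>
      simp only [List.nil_append, List.map_cons, List.nodup_cons, List.mem_cons, not_or] at hnd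
      obtain ⟨⟨hxy, hx2⟩, hy2, -⟩ := hnd
      simp only [List.nil_append, monodromy_cons]
      rw [← Matrix.mul_assoc, ← Matrix.mul_assoc, Matrix.mul_apply, Matrix.mul_apply, Finset.sum_mul,
        Finset.mul_sum]
      refine Finset.sum_congr rfl fun r _ => ?_
      rw [mul_assoc, monodromy_comm_swapR η lam l₂ hx2 hy2, ← mul_assoc,
        show s - s' = (lam - s') - (lam - s) by ring, lax_lax_swap η hxy, mul_assoc]
  | cons p l₁ ih =>
      rw [List.cons_append, List.map_cons, List.nodup_cons] at hnd
      obtain ⟨hp, hnd'⟩ := hnd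
      have hpx : p.1 ≠ x := fun h => hp (by rw [h]; simp)
      have hpy : p.1 ≠ y := fun h => hp (by rw [h]; simp)
      rw [List.cons_append, List.cons_append, monodromy_cons, monodromy_cons, Matrix.mul_apply,
        Matrix.mul_apply, Finset.sum_mul, Finset.mul_sum]
      refine Finset.sum_congr rfl fun r _ => ?_
      rw [mul_assoc, ih hnd' r b, ← mul_assoc, lax_comm_swapR η hpx hpy, mul_assoc]


/-- `P_{xy}|0⟩ = |0⟩`. [folklore] -/
theorem swapOp_mulVec_vac {x y : Λ} (hxy : x ≠ y) :
    swapOp x y *ᵥ vac = (vac : TensorIndex Λ 2 → ℂ) := by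
  unfold swapOp
  simp only [Fin.sum_univ_two, add_mulVec]
  simp only [← mulVec_mulVec, sUnit_zero_zero_mulVec_vac,
    sUnit_mulVec_vac_of_ne_zero _ _ one_ne_zero, mulVec_zero, add_zero]
  rw [mulVec_mulVec, sUnit_comm hxy, ← mulVec_mulVec, sUnit_mulVec_vac_of_ne_zero x 0 one_ne_zero,
    mulVec_zero, add_zero]

/-- The intertwiner acts on the reference state as the scalar `v + η`. [folklore] -/
theorem swapR_mulVec_vac {x y : Λ} (hxy : x ≠ y) (η v : ℂ) :
    (v • (1 : Op Λ 2) + η • swapOp x y) *ᵥ vac = (v + η) • (vac : TensorIndex Λ 2 → ℂ) := by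
  rw [add_mulVec, smul_mulVec, smul_mulVec, one_mulVec, swapOp_mulVec_vac hxy, add_smul]

/-- Exchange of adjacent inhomogeneities for `B`-strings:
`𝔅(λ⃗) R = R 𝔅'(λ⃗)`. [cite: EsslerEtAl2005, eq. (3.B.31)] -/
theorem bString_swap (η : ℂ) {x y : Λ} {s s' : ℂ} (l₁ l₂ : List (Λ × ℂ))
    (hnd : ((l₁ ++ (x, s) :: (y, s') :: l₂).map Prod.fst).Nodup) (lams : List ℂ) :
    bString η (l₁ ++ (x, s) :: (y, s') :: l₂) lams * ((s - s') • (1 : Op Λ 2) + η • swapOp x y) =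
      ((s - s') • (1 : Op Λ 2) + η • swapOp x y) * bString η (l₁ ++ (y, s') :: (x, s) :: l₂) lams := by
  induction lams with
  | nil => rw [bString_nil, bString_nil, one_mul, mul_one]
  | cons mu rest ih =>
      rw [bString_cons, bString_cons, mul_assoc, ih, ← mul_assoc, opB, monodromy_swap η mu l₁ l₂ hnd,
        mul_assoc, opB]

/-- **Essler et al. (3.B.31) for the Bethe vectors**: interchanging two adjacent inhomogeneities
multiplies the Bethe vector `𝔅(λ⃗)|0⟩` by the `Y`-operator, in the cleared form
`R Φ' = (s - s' + η) Φ` with `R = (s - s') + η P_{xy}`, i.e. `Φ = Y_{xy}(s - s') Φ'` for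
`Y(v) = (v + η P)/(v + η)`. [cite: EsslerEtAl2005, eqs. (3.B.31)–(3.B.32)] -/
theorem swapR_mulVec_bString_vac (η : ℂ) {x y : Λ} {s s' : ℂ} (l₁ l₂ : List (Λ × ℂ))
    (hnd : ((l₁ ++ (x, s) :: (y, s') :: l₂).map Prod.fst).Nodup) (lams : List ℂ) :
    ((s - s') • (1 : Op Λ 2) + η • swapOp x y) *ᵥ
        (bString η (l₁ ++ (y, s') :: (x, s) :: l₂) lams *ᵥ vac) =
      (s - s' + η) • (bString η (l₁ ++ (x, s) :: (y, s') :: l₂) lams *ᵥ vac) := by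
  have hxy : x ≠ y := by
    have h := (List.nodup_append.1 (by simpa only [List.map_append] using hnd)).2.1
    simp only [List.map_cons, List.nodup_cons, List.mem_cons, not_or] at h
    exact h.1.1
  rw [mulVec_mulVec, ← bString_swap η l₁ l₂ hnd, ← mulVec_mulVec, swapR_mulVec_vac hxy, mulVec_smul]

end InhomXXX

end Literature.MathematicalPhysics.QuantumLattice
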